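import Summits.ABC.ABC.Theorems.TwistAmplificationMazurKaneLawDELatticeBox

-- Summit.ABC.ABC is the mandated summit-side namespace (single-conjunct summit); the lakefile sets the same option tree-wide.
set_option linter.dupNamespace false

/-!
# Dyadic summation of the lattice-box counts over a family of congruence lattices

Stub `de_sum_latticeCount_dyadic_le` of the DE tool for the line
`critical-kloosterman-powerful-moduli` of the crux `stmt-ABC-2757`
(`Summit.ABC.ABC.Theses.TwistAmplification.MazurKaneLaw`).

For a finite family `Φ` of lattices `Λ_φ = {(a, b) ∈ ℤ² : q_φ ∣ a - λ_φ b}` with moduli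
`q_min ≤ q_φ ≤ 2 ^ K`, the landed box count `de_latticeBox_card_le` gives
`#(Λ_φ ∩ [1, S]²) ≤ 20 S² / q_φ + 4 S / n₀(φ) + 5`, where `n₀(φ) ≥ 1` is the sup-norm of a
shortest nonzero vector of `Λ_φ` (`de_exists_minSupNorm`). Writing
`2 ^ k₀ ≤ n₀(φ) < 2 ^ (k₀ + 1)` one has `4 S / n₀(φ) ≤ 8 S / 2 ^ (k₀ + 1)`, the lattice `Λ_φ` has
a nonzero vector in `[-2 ^ (k₀ + 1), 2 ^ (k₀ + 1)]²`, and `k₀ + 1 < K + 2`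
(`de_latticeCount_le_dyadic`). Summing over `φ ∈ Φ` and exchanging the order of summation
(`de_sum_le_card_mul_add_dyadic`) gives the dyadic bound
`Σ_φ #(Λ_φ ∩ [1, S]²) ≤ #Φ (20 S² / q_min + 5) + 8 S Σ_{k < K + 2} 2^{-k} #{φ : Λ_φ has a nonzero
vector in [-2^k, 2^k]²}` (`de_sum_latticeCount_dyadic_le`).
-/

namespace Summit.ABC.ABC.Theorems.MazurKaneLaw

open Finset

/-- **Shortest nonzero vector of the lattice `{(a, b) : q ∣ a - λ b}`.** For `q ≥ 1` there is
`n₀` with `1 ≤ n₀ ≤ q` such that some nonzero `(a, b)` with `q ∣ a - λ b` has `|a|, |b| ≤ n₀`,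
while every nonzero such `(a, b)` has `max (|a|, |b|) ≥ n₀` (take `n₀` minimal; `(q, 0)` is a
nonzero lattice vector, and `n₀ = 0` would force `(a, b) = (0, 0)`). [folklore] -/
theorem de_exists_minSupNorm (q : ℕ) (lam : ℤ) (hq : 0 < q) :
    ∃ n₀ : ℕ, 0 < n₀ ∧ n₀ ≤ q ∧
      (∃ a b : ℤ, |a| ≤ n₀ ∧ |b| ≤ n₀ ∧ (a, b) ≠ (0, 0) ∧ (q : ℤ) ∣ a - lam * b) ∧
      (∀ a b : ℤ, (q : ℤ) ∣ a - lam * b → (a, b) ≠ (0, 0) → (n₀ : ℤ) ≤ max |a| |b|) := by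
  classical
  have hPq : ∃ a b : ℤ, |a| ≤ (q : ℕ) ∧ |b| ≤ (q : ℕ) ∧ (a, b) ≠ (0, 0) ∧
      (q : ℤ) ∣ a - lam * b :=
    ⟨q, 0, by simp, by simp, by simp [hq.ne'], by simp⟩
  have hex : ∃ n : ℕ, ∃ a b : ℤ, |a| ≤ n ∧ |b| ≤ n ∧ (a, b) ≠ (0, 0) ∧
      (q : ℤ) ∣ a - lam * b := ⟨q, hPq⟩
  refine ⟨Nat.find hex, ?_, Nat.find_min' hex hPq, Nat.find_spec hex, ?_⟩
  · rw [Nat.find_pos]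
    rintro ⟨a, b, ha, hb, hne, -⟩
    rw [Nat.cast_zero, abs_nonpos_iff] at ha hb
    exact hne (by rw [ha, hb])
  · intro a b hdvd hne
    by_contra hlt
    rw [not_le] at hlt
    have h0 : 0 ≤ max |a| |b| := (abs_nonneg a).trans (le_max_left _ _)
    have hm : ((max |a| |b|).toNat : ℤ) = max |a| |b| := Int.toNat_of_nonneg h0
    have hmlt : (max |a| |b|).toNat < Nat.find hex := by
      have : ((max |a| |b|).toNat : ℤ) < Nat.find hex := by rw [hm]; exact hlt
      exact_mod_cast this
    exact Nat.find_min hex hmlt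
      ⟨a, b, by rw [hm]; exact le_max_left _ _, by rw [hm]; exact le_max_right _ _, hne, hdvd⟩

/-- **Pointwise dyadic bound.** For `0 < q_min ≤ q ≤ 2 ^ K` and `λ ∈ ℤ` there is a dyadic level
`k < K + 2` such that the lattice `{(a, b) : q ∣ a - λ b}` has a nonzero vector in `[-2^k, 2^k]²`
and `#{(a, b) ∈ [1, S]² : q ∣ a - λ b} ≤ 20 S² / q_min + 5 + 8 S · 2^{-k}`: with `n₀` the sup-norm
of a shortest nonzero lattice vector and `2 ^ k₀ ≤ n₀ < 2 ^ (k₀ + 1)`, take `k = k₀ + 1` and use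
`de_latticeBox_card_le` with `M = n₀`. [folklore] -/
theorem de_latticeCount_le_dyadic (q : ℕ) (lam : ℤ) (S qmin K : ℕ) (hqmin : 0 < qmin)
    (hq : qmin ≤ q) (hqK : q ≤ 2 ^ K) :
    ∃ k : ℕ, k < K + 2 ∧
      (∃ a ∈ Finset.Icc (-((2 : ℤ) ^ k)) ((2 : ℤ) ^ k),
        ∃ b ∈ Finset.Icc (-((2 : ℤ) ^ k)) ((2 : ℤ) ^ k), (a, b) ≠ (0, 0) ∧ (q : ℤ) ∣ a - lam * b) ∧
      ((((Finset.Icc (1 : ℤ) S ×ˢ Finset.Icc (1 : ℤ) S).filter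
          (fun p : ℤ × ℤ => (q : ℤ) ∣ p.1 - lam * p.2)).card : ℝ) ≤
        20 * (S : ℝ) ^ 2 / qmin + 5 + 8 * (S : ℝ) * (1 / (2 : ℝ) ^ k)) := by
  have hq0 : 0 < q := hqmin.trans_le hq
  obtain ⟨n₀, hn₀, hn₀q, ⟨a, b, ha, hb, hne, hdvd⟩, hlong⟩ := de_exists_minSupNorm q lam hq0
  have h1 : 2 ^ Nat.log 2 n₀ ≤ n₀ := Nat.pow_log_le_self 2 hn₀.ne'
  have h2 : n₀ < 2 ^ (Nat.log 2 n₀ + 1) := Nat.lt_pow_succ_log_self (by norm_num) n₀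
  have h3 : Nat.log 2 n₀ ≤ K :=
    calc Nat.log 2 n₀ ≤ Nat.log 2 (2 ^ K) := Nat.log_mono_right (hn₀q.trans hqK)
      _ = K := Nat.log_pow (by norm_num) K
  refine ⟨Nat.log 2 n₀ + 1, by omega, ?_, ?_⟩
  · have h2' : (n₀ : ℤ) ≤ (2 : ℤ) ^ (Nat.log 2 n₀ + 1) := by exact_mod_cast h2.le
    refine ⟨a, ?_, b, ?_, hne, hdvd⟩
    · rw [Finset.mem_Icc, ← abs_le]
      exact ha.trans h2'
    · rw [Finset.mem_Icc, ← abs_le]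
      exact hb.trans h2'
  · have hcount := de_latticeBox_card_le q lam S n₀ hq0 hn₀ hlong
    have hqmin' : (0 : ℝ) < qmin := by exact_mod_cast hqmin
    have hq' : (qmin : ℝ) ≤ q := by exact_mod_cast hq
    have hA : 20 * (S : ℝ) ^ 2 / q ≤ 20 * (S : ℝ) ^ 2 / qmin :=
      div_le_div_of_nonneg_left (by positivity) hqmin' hq'
    have h1' : (2 : ℝ) ^ Nat.log 2 n₀ ≤ n₀ := by exact_mod_cast h1
    have hB : 4 * (S : ℝ) / n₀ ≤ 4 * (S : ℝ) / (2 : ℝ) ^ Nat.log 2 n₀ :=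
      div_le_div_of_nonneg_left (by positivity) (by positivity) h1'
    have hC : 4 * (S : ℝ) / (2 : ℝ) ^ Nat.log 2 n₀ =
        8 * (S : ℝ) * (1 / (2 : ℝ) ^ (Nat.log 2 n₀ + 1)) := by
      rw [pow_succ]
      field_simp
      ring
    linarith

/-- **Dyadic rearrangement.** If every `φ ∈ Φ` admits a level `k < N` with `sh k φ` and
`f φ ≤ C + D · 2^{-k}` (`D ≥ 0`), then
`Σ_{φ ∈ Φ} f φ ≤ #Φ · C + D · Σ_{k < N} 2^{-k} · #{φ ∈ Φ : sh k φ}` (single out the term `k`,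
then exchange the order of summation). [folklore] -/
theorem de_sum_le_card_mul_add_dyadic {ι : Type} (Φ : Finset ι) (f : ι → ℝ) (C D : ℝ) (N : ℕ)
    (sh : ℕ → ι → Prop) [∀ k, DecidablePred (sh k)] (hD : 0 ≤ D)
    (h : ∀ φ ∈ Φ, ∃ k : ℕ, k < N ∧ sh k φ ∧ f φ ≤ C + D * (1 / (2 : ℝ) ^ k)) :
    ∑ φ ∈ Φ, f φ ≤
      (Φ.card : ℝ) * C +
        D * ∑ k ∈ Finset.range N, (1 / (2 : ℝ) ^ k) * ((Φ.filter (sh k)).card : ℝ) := by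
  have key : ∀ φ ∈ Φ, f φ ≤
      C + D * ∑ k ∈ Finset.range N, (if sh k φ then 1 / (2 : ℝ) ^ k else 0) := by
    intro φ hφ
    obtain ⟨k, hk, hsh, hf⟩ := h φ hφ
    have hnn : ∀ i ∈ Finset.range N, (0 : ℝ) ≤ if sh i φ then 1 / (2 : ℝ) ^ i else 0 :=
      fun i _ => by split_ifs <;> positivity
    have hsingle : (if sh k φ then 1 / (2 : ℝ) ^ k else 0) ≤
        ∑ k ∈ Finset.range N, (if sh k φ then 1 / (2 : ℝ) ^ k else 0) :=
      Finset.single_le_sum hnn (Finset.mem_range.mpr hk)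
    rw [if_pos hsh] at hsingle
    exact hf.trans (add_le_add le_rfl (mul_le_mul_of_nonneg_left hsingle hD))
  have hinner : ∀ k ∈ Finset.range N,
      ∑ φ ∈ Φ, (if sh k φ then 1 / (2 : ℝ) ^ k else 0) =
        (1 / (2 : ℝ) ^ k) * ((Φ.filter (sh k)).card : ℝ) := by
    intro k _
    rw [← Finset.sum_filter, Finset.sum_const, nsmul_eq_mul]
    exact mul_comm _ _
  calc ∑ φ ∈ Φ, f φ
      ≤ ∑ φ ∈ Φ, (C + D * ∑ k ∈ Finset.range N, (if sh k φ then 1 / (2 : ℝ) ^ k else 0)) :=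
        Finset.sum_le_sum key
    _ = (Φ.card : ℝ) * C +
          D * ∑ k ∈ Finset.range N, (1 / (2 : ℝ) ^ k) * ((Φ.filter (sh k)).card : ℝ) := by
        rw [Finset.sum_add_distrib, Finset.sum_const, nsmul_eq_mul, ← Finset.mul_sum,
          Finset.sum_comm, Finset.sum_congr rfl hinner]

/-- **Dyadic short-vector sum (DE tool).** For a finite family of congruence lattices
`Λ_φ = {(a, b) : q_φ ∣ a - λ_φ b}`, `φ ∈ Φ`, with `0 < q_min ≤ q_φ ≤ 2 ^ K`:
`Σ_{φ ∈ Φ} #(Λ_φ ∩ [1, S]²) ≤ #Φ · (20 S² / q_min + 5)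
  + 8 S · Σ_{k < K + 2} 2^{-k} · #{φ ∈ Φ : Λ_φ has a nonzero vector in [-2^k, 2^k]²}`
(`de_latticeBox_card_le` with `M` the sup-norm of a shortest nonzero vector of `Λ_φ`, located in
its dyadic range, then the order of summation exchanged). [folklore] -/
theorem de_sum_latticeCount_dyadic_le : ∀ {ι : Type} (Φ : Finset ι) (qf : ι → ℕ) (lam : ι → ℤ) (S qmin K : ℕ), 0 < qmin → (∀ φ ∈ Φ, qmin ≤ qf φ) → (∀ φ ∈ Φ, qf φ ≤ 2 ^ K) → (∑ φ ∈ Φ, (((Finset.Icc (1 : ℤ) S ×ˢ Finset.Icc (1 : ℤ) S).filter (fun p : ℤ × ℤ => (qf φ : ℤ) ∣ p.1 - lam φ * p.2)).card : ℝ)) ≤ (Φ.card : ℝ) * (20 * (S : ℝ) ^ 2 / qmin + 5) + 8 * (S : ℝ) * ∑ k ∈ Finset.range (K + 2), (1 / (2 : ℝ) ^ k) * ((Φ.filter (fun φ => ∃ a ∈ Finset.Icc (-((2 : ℤ) ^ k)) ((2 : ℤ) ^ k), ∃ b ∈ Finset.Icc (-((2 : ℤ) ^ k)) ((2 : ℤ)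 ^ k), (a, b) ≠ (0, 0) ∧ (qf φ : ℤ) ∣ a - lam φ * b)).card : ℝ) := by
  intro ι Φ qf lam S qmin K hqmin hge hle
  exact de_sum_le_card_mul_add_dyadic Φ _ _ _ (K + 2)
    (fun k φ => ∃ a ∈ Finset.Icc (-((2 : ℤ) ^ k)) ((2 : ℤ) ^ k),
      ∃ b ∈ Finset.Icc (-((2 : ℤ) ^ k)) ((2 : ℤ) ^ k), (a, b) ≠ (0, 0) ∧ (qf φ : ℤ) ∣ a - lam φ * b)
    (by positivity)
    (fun φ hφ => de_latticeCount_le_dyadic (qf φ) (lam φ) S qmin K hqmin (hge φ hφ) (hle φ hφ))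

end Summit.ABC.ABC.Theorems.MazurKaneLaw
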